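import Summits.AtomisticToContinuum.HydrodynamicLimit.Theorems.EnskogAdjointDualityAdjointEnskogTestFamilyRCorrectorPointwise
import HarnessLib

/-!
# K2R transfer bound II: the pointwise replacement in the position × direction integrand

Route `EnskogAdjointDuality` of `AtomisticToContinuum/HydrodynamicLimit`, crux `AdjointEnskogTestFamilyR`
(stmt-AtomisticToContinuum-11592, "K2R"), line `birth`, stub `stub_transferBound` (G3b), helper II.

After the reduction of the hydrodynamic collisional transfer to position × direction form (G3a), its
integrand at `(x, ω)` is `F = −Y(x+εω/2) ρ(x) ρ(y) [ (β(x)−β(y))·ω · J₁ + (γ(x)−γ(y)) · J₂ ]`, `y = x + εω`,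
with the Gaussian pair integrals `J₁, J₂` of the two local Maxwellians at `x` and `y`.  Here we replace,
at the cost `O(ε²)` pointwise and uniformly: `J₁ → θ(x)`, `J₂ → θ(x) (u(x)·ω)` (Lipschitz dependence of
the pair integrals on the second Maxwellian, stub B3a (iii), against the `O(ε)` increments of the
Lipschitz coefficients `β, γ`), `ρ(y) → ρ(x)` and `Y(x+εω/2) → Y(x)`:
`|F − F₀| ≤ K_A ε²`, `F₀ = −W(x) (β(x)−β(y))·ω − W(x) (u(x)·ω) (γ(x)−γ(y))`, `W = Y ρ² θ`.

* `k2r_tb_alg` — the underlying inequality between real numbers;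
* `k2r_tb_pointwise` — the estimate for continuous slices `(ρ₀, θ₀, u₀)`, contact factor `Yc`,
  coefficients `c₀ = (α, β, γ)` (registered sub-goal `stub_transferBound_pointwise`).

References: C. Cercignani, R. Illner, M. Pulvirenti, *The Mathematical Theory of Dilute Gases* (1994),
§3.1 [CIP1994]; S. Chapman, T. G. Cowling, *The Mathematical Theory of Non-uniform Gases* (1970), §16.
-/

noncomputable section

open MeasureTheory Metric Set Filter Topology Function
open scoped InnerProductSpace

namespace Summit.AtomisticToContinuum.HydrodynamicLimit.Theorems.EnskogAdjointDuality

open Literature.Analysis.FluidPDE Literature.MathematicalPhysics.KineticTheory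

/-! ## Elementary inequalities -/

/-- **The algebra of the pointwise replacement.** If `|P| ≤ p`, `|P − P₀| ≤ q ε`, `|dβ|, |dγ| ≤ C ε`,
`|J₁ − θ|, |J₂ − θ uω| ≤ j ε`, `|θ| ≤ Θ`, `|uω| ≤ U`, then
`|−P (dβ J₁ + dγ J₂) − (−(P₀ θ) dβ − (P₀ θ uω) dγ)| ≤ (2 p C j + q Θ C (1 + U)) ε²`. [folklore] -/
theorem k2r_tb_alg {P P₀ θ uω dβ dγ J₁ J₂ p q C j Θ U ε : ℝ} (hP : |P| ≤ p) (hPP : |P - P₀| ≤ q * ε)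
    (hdβ : |dβ| ≤ C * ε) (hdγ : |dγ| ≤ C * ε) (hJ₁ : |J₁ - θ| ≤ j * ε) (hJ₂ : |J₂ - θ * uω| ≤ j * ε)
    (hθ : |θ| ≤ Θ) (hu : |uω| ≤ U) :
    |-(P * (dβ * J₁ + dγ * J₂)) - (-(P₀ * θ * dβ) - P₀ * θ * uω * dγ)| ≤
      (2 * p * C * j + q * Θ * C * (1 + U)) * ε ^ 2 := by
  -- `|a b c| ≤ A B C'` and `|a b c d| ≤ A B C' D` from the individual bounds
  have mul₃ : ∀ {a b c A B C' : ℝ}, |a| ≤ A → |b| ≤ B → |c| ≤ C' → |a * b * c| ≤ A * B * C' := by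
    intro a b c A B C' ha hb hc
    have hA : 0 ≤ A := (abs_nonneg a).trans ha
    have hB : 0 ≤ B := (abs_nonneg b).trans hb
    rw [abs_mul, abs_mul]
    exact mul_le_mul (mul_le_mul ha hb (abs_nonneg b) hA) hc (abs_nonneg c) (mul_nonneg hA hB)
  have mul₄ : ∀ {a b c d A B C' D : ℝ}, |a| ≤ A → |b| ≤ B → |c| ≤ C' → |d| ≤ D →
      |a * b * c * d| ≤ A * B * C' * D := by
    intro a b c d A B C' D ha hb hc hd
    have hA : 0 ≤ A := (abs_nonneg a).trans ha
    have hB : 0 ≤ B := (abs_nonneg b).trans hb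
    have hC : 0 ≤ C' := (abs_nonneg c).trans hc
    rw [abs_mul]
    exact mul_le_mul (mul₃ ha hb hc) hd (abs_nonneg d) (by positivity)
  have hsplit : -(P * (dβ * J₁ + dγ * J₂)) - (-(P₀ * θ * dβ) - P₀ * θ * uω * dγ) =
      -(P * dβ * (J₁ - θ)) + -(P * dγ * (J₂ - θ * uω)) + -((P - P₀) * θ * dβ) +
        -((P - P₀) * θ * uω * dγ) := by ring
  rw [hsplit]
  have h1 : |P * dβ * (J₁ - θ)| ≤ p * (C * ε) * (j * ε) := mul₃ hP hdβ hJ₁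
  have h2 : |P * dγ * (J₂ - θ * uω)| ≤ p * (C * ε) * (j * ε) := mul₃ hP hdγ hJ₂
  have h3 : |(P - P₀) * θ * dβ| ≤ (q * ε) * Θ * (C * ε) := mul₃ hPP hθ hdβ
  have h4 : |(P - P₀) * θ * uω * dγ| ≤ (q * ε) * Θ * U * (C * ε) := mul₄ hPP hθ hu hdγ
  calc |-(P * dβ * (J₁ - θ)) + -(P * dγ * (J₂ - θ * uω)) + -((P - P₀) * θ * dβ) +
        -((P - P₀) * θ * uω * dγ)|
      ≤ |-(P * dβ * (J₁ - θ))| + |-(P * dγ * (J₂ - θ * uω))| + |-((P - P₀) * θ * dβ)| +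
        |-((P - P₀) * θ * uω * dγ)| := by
        refine (abs_add_le _ _).trans (add_le_add ((abs_add_le _ _).trans (add_le_add
          (abs_add_le _ _) le_rfl)) le_rfl)
    _ ≤ p * (C * ε) * (j * ε) + p * (C * ε) * (j * ε) + (q * ε) * Θ * (C * ε) +
        (q * ε) * Θ * U * (C * ε) := by
        rw [abs_neg, abs_neg, abs_neg, abs_neg]
        exact add_le_add (add_le_add (add_le_add h1 h2) h3) h4
    _ = (2 * p * C * j + q * Θ * C * (1 + U)) * ε ^ 2 := by ring

/-! ## Components of the coefficient triple `(α, β, γ) ∈ ℝ × ℝ³ × ℝ` -/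

/-- The vector component of the coefficient triple is bounded by the (sup) norm of the triple. [folklore] -/
theorem k2r_tb_norm_snd_fst_le (p : ℝ × V3 × ℝ) : ‖p.2.1‖ ≤ ‖p‖ :=
  (norm_fst_le p.2).trans (norm_snd_le p)

/-- The last scalar component of the coefficient triple is bounded by the norm of the triple. [folklore] -/
theorem k2r_tb_abs_snd_snd_le (p : ℝ × V3 × ℝ) : |p.2.2| ≤ ‖p‖ := by
  rw [← Real.norm_eq_abs]
  exact (norm_snd_le p.2).trans (norm_snd_le p)

/-- Increments of the vector component are bounded by the distance of the triples. [folklore] -/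
theorem k2r_tb_norm_snd_fst_sub_le (p q : ℝ × V3 × ℝ) : ‖p.2.1 - q.2.1‖ ≤ dist p q := by
  rw [← dist_eq_norm, Prod.dist_eq, Prod.dist_eq]
  exact (le_max_left _ _).trans (le_max_right _ _)

/-- Increments of the last scalar component are bounded by the distance of the triples. [folklore] -/
theorem k2r_tb_abs_snd_snd_sub_le (p q : ℝ × V3 × ℝ) : |p.2.2 - q.2.2| ≤ dist p q := by
  rw [← Real.dist_eq, Prod.dist_eq, Prod.dist_eq]
  exact (le_max_right _ _).trans (le_max_right _ _)

/-! ## The pointwise replacement -/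

/-- **Pointwise replacement in the transfer integrand.** Fix a time slice: continuous background
`(ρ₀, θ₀, u₀)` with `0 ≤ ρ₀ ≤ R`, `θm ≤ θ₀ ≤ Θ`, `‖u₀‖ ≤ U`, `Lb`-Lipschitz in `x`; a contact factor `Yc`
with `|Yc| ≤ Ȳ`, `LY`-Lipschitz; coefficients `c₀ = (α, β, γ)` with `‖c₀‖ ≤ C`, `C`-Lipschitz; and the
Lipschitz constant `K_J` of the Gaussian pair integrals on the parameter range (stub B3a (iii)).  Then for
`0 ≤ ε`, every `x` and every direction `ω`, with `y = x + εω`,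
`|−Y(x+εω/2)ρ(x)ρ(y)[(β(x)−β(y))·ω J₁ + (γ(x)−γ(y)) J₂] − (−W(x)(β(x)−β(y))·ω − W(x)(u(x)·ω)(γ(x)−γ(y)))|`
`≤ (2(ȲR²)C(2K_J Lb) + (LY R²/2 + ȲRLb) Θ C (1+U)) ε²`, `W = Yc ρ₀² θ₀`. [cite: CIP1994, §3.1] -/
theorem k2r_tb_pointwise {θm Θ U R Lb Yb LY C KJ : ℝ} (hθm : 0 < θm)
    {ρ₀ θ₀ : T3 → ℝ} {u₀ : T3 → V3} {Yc : T3 → ℝ} {c₀ : T3 → ℝ × V3 × ℝ}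
    (hρ : ∀ x, 0 ≤ ρ₀ x ∧ ρ₀ x ≤ R) (hθ : ∀ x, θm ≤ θ₀ x ∧ θ₀ x ≤ Θ) (hu : ∀ x, ‖u₀ x‖ ≤ U)
    (hLb : 0 ≤ Lb) (hLip : ∀ x x', |ρ₀ x - ρ₀ x'| ≤ Lb * dist x x' ∧ |θ₀ x - θ₀ x'| ≤ Lb * dist x x' ∧
      ‖u₀ x - u₀ x'‖ ≤ Lb * dist x x')
    (hY : ∀ x, |Yc x| ≤ Yb) (hLY : 0 ≤ LY) (hYL : ∀ x x', |Yc x - Yc x'| ≤ LY * dist x x')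
    (hc : ∀ x x', ‖c₀ x‖ ≤ C ∧ dist (c₀ x) (c₀ x') ≤ C * dist x x')
    (hKJ0 : 0 ≤ KJ) (hKJ : ∀ (θ θ' : ℝ) (u u' : V3) (ω : sphere (0 : V3) 1),
      θm ≤ θ → θ ≤ Θ → θm ≤ θ' → θ' ≤ Θ → ‖u‖ ≤ U → ‖u'‖ ≤ U →
      |(∫ v : V3, ∫ w : V3, max ⟪v - w, (ω : V3)⟫_ℝ 0 * ⟪v - w, (ω : V3)⟫_ℝ *
          (localMaxwellian 1 θ u v * localMaxwellian 1 θ' u' w)) - θ| ≤ KJ * (|θ - θ'| + ‖u - u'‖) ∧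
      |(∫ v : V3, ∫ w : V3, max ⟪v - w, (ω : V3)⟫_ℝ 0 * ⟪v - w, (ω : V3)⟫_ℝ * (⟪v + w, (ω : V3)⟫_ℝ / 2) *
          (localMaxwellian 1 θ u v * localMaxwellian 1 θ' u' w)) - θ * ⟪u, (ω : V3)⟫_ℝ| ≤
        KJ * (|θ - θ'| + ‖u - u'‖))
    {ε : ℝ} (hε0 : 0 ≤ ε) (x : T3) (ω : sphere (0 : V3) 1) :
    |-(Yc ((Torus.geometry (Fin 3)).translate x ((ε / 2) • (ω : V3))) * ρ₀ x *
          ρ₀ ((Torus.geometry (Fin 3)).translate x (ε • (ω : V3))) *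
        (⟪(c₀ x).2.1 - (c₀ ((Torus.geometry (Fin 3)).translate x (ε • (ω : V3)))).2.1, (ω : V3)⟫_ℝ *
          (∫ v : V3, ∫ w : V3, max ⟪v - w, (ω : V3)⟫_ℝ 0 * ⟪v - w, (ω : V3)⟫_ℝ *
            (localMaxwellian 1 (θ₀ x) (u₀ x) v *
              localMaxwellian 1 (θ₀ ((Torus.geometry (Fin 3)).translate x (ε • (ω : V3))))
                (u₀ ((Torus.geometry (Fin 3)).translate x (ε • (ω : V3)))) w)) +
        ((c₀ x).2.2 - (c₀ ((Torus.geometry (Fin 3)).translate x (ε • (ω : V3)))).2.2) *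
          (∫ v : V3, ∫ w : V3, max ⟪v - w, (ω : V3)⟫_ℝ 0 * ⟪v - w, (ω : V3)⟫_ℝ * (⟪v + w, (ω : V3)⟫_ℝ / 2) *
            (localMaxwellian 1 (θ₀ x) (u₀ x) v *
              localMaxwellian 1 (θ₀ ((Torus.geometry (Fin 3)).translate x (ε • (ω : V3))))
                (u₀ ((Torus.geometry (Fin 3)).translate x (ε • (ω : V3)))) w)))) -
      (-(Yc x * ρ₀ x ^ 2 * θ₀ x *
          ⟪(c₀ x).2.1 - (c₀ ((Torus.geometry (Fin 3)).translate x (ε • (ω : V3)))).2.1, (ω : V3)⟫_ℝ) -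
        Yc x * ρ₀ x ^ 2 * θ₀ x * ⟪u₀ x, (ω : V3)⟫_ℝ *
          ((c₀ x).2.2 - (c₀ ((Torus.geometry (Fin 3)).translate x (ε • (ω : V3)))).2.2))| ≤
      (2 * (Yb * R * R) * C * (KJ * (2 * Lb)) + (LY * R * R / 2 + Yb * R * Lb) * Θ * C * (1 + U)) *
        ε ^ 2 := by
  set y : T3 := (Torus.geometry (Fin 3)).translate x (ε • (ω : V3)) with hy
  set xh : T3 := (Torus.geometry (Fin 3)).translate x ((ε / 2) • (ω : V3)) with hxh
  set J₁ : ℝ := ∫ v : V3, ∫ w : V3, max ⟪v - w, (ω : V3)⟫_ℝ 0 * ⟪v - w, (ω : V3)⟫_ℝ *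
    (localMaxwellian 1 (θ₀ x) (u₀ x) v * localMaxwellian 1 (θ₀ y) (u₀ y) w) with hJ₁
  set J₂ : ℝ := ∫ v : V3, ∫ w : V3, max ⟪v - w, (ω : V3)⟫_ℝ 0 * ⟪v - w, (ω : V3)⟫_ℝ *
    (⟪v + w, (ω : V3)⟫_ℝ / 2) * (localMaxwellian 1 (θ₀ x) (u₀ x) v * localMaxwellian 1 (θ₀ y) (u₀ y) w)
    with hJ₂
  -- distances of the shifted points
  have hdy : dist x y ≤ ε := k2r_dist_translate_smul_le x ω hε0
  have hdxh : dist xh x ≤ ε / 2 := by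
    rw [dist_comm]; exact k2r_dist_translate_smul_le x ω (by linarith)
  -- the individual bounds (`|a b c| ≤ A B C'` from the three bounds)
  have mul₃ : ∀ {a b c A B C' : ℝ}, |a| ≤ A → |b| ≤ B → |c| ≤ C' → |a * b * c| ≤ A * B * C' := by
    intro a b c A B C' ha hb hc
    have hA : 0 ≤ A := (abs_nonneg a).trans ha
    have hB : 0 ≤ B := (abs_nonneg b).trans hb
    rw [abs_mul, abs_mul]
    exact mul_le_mul (mul_le_mul ha hb (abs_nonneg b) hA) hc (abs_nonneg c) (mul_nonneg hA hB)
  have hρx : |ρ₀ x| ≤ R := by rw [abs_of_nonneg (hρ x).1]; exact (hρ x).2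
  have hρy : |ρ₀ y| ≤ R := by rw [abs_of_nonneg (hρ y).1]; exact (hρ y).2
  have hP : |Yc xh * ρ₀ x * ρ₀ y| ≤ Yb * R * R := mul₃ (hY xh) hρx hρy
  have hPP : |Yc xh * ρ₀ x * ρ₀ y - Yc x * ρ₀ x ^ 2| ≤ (LY * R * R / 2 + Yb * R * Lb) * ε := by
    have hsplit : Yc xh * ρ₀ x * ρ₀ y - Yc x * ρ₀ x ^ 2 =
        (Yc xh - Yc x) * ρ₀ x * ρ₀ y + Yc x * ρ₀ x * (ρ₀ y - ρ₀ x) := by ring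
    rw [hsplit]
    have h1 : |Yc xh - Yc x| ≤ LY * (ε / 2) := (hYL xh x).trans (mul_le_mul_of_nonneg_left hdxh hLY)
    have h2 : |ρ₀ y - ρ₀ x| ≤ Lb * ε := by
      refine (hLip y x).1.trans (mul_le_mul_of_nonneg_left ?_ hLb)
      rwa [dist_comm]
    calc |(Yc xh - Yc x) * ρ₀ x * ρ₀ y + Yc x * ρ₀ x * (ρ₀ y - ρ₀ x)|
        ≤ |(Yc xh - Yc x) * ρ₀ x * ρ₀ y| + |Yc x * ρ₀ x * (ρ₀ y - ρ₀ x)| := abs_add_le _ _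
      _ ≤ LY * (ε / 2) * R * R + Yb * R * (Lb * ε) :=
          add_le_add (mul₃ h1 hρx hρy) (mul₃ (hY x) hρx h2)
      _ = (LY * R * R / 2 + Yb * R * Lb) * ε := by ring
  have hcd : dist (c₀ x) (c₀ y) ≤ C * ε := by
    refine (hc x y).2.trans ?_
    have hC : 0 ≤ C := (norm_nonneg _).trans (hc x y).1
    exact mul_le_mul_of_nonneg_left hdy hC
  have hdβ : |⟪(c₀ x).2.1 - (c₀ y).2.1, (ω : V3)⟫_ℝ| ≤ C * ε :=
    ((k2r_abs_inner_sphere_le ω _).trans (k2r_tb_norm_snd_fst_sub_le _ _)).trans hcd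
  have hdγ : |(c₀ x).2.2 - (c₀ y).2.2| ≤ C * ε := (k2r_tb_abs_snd_snd_sub_le _ _).trans hcd
  have hpar : |θ₀ x - θ₀ y| + ‖u₀ x - u₀ y‖ ≤ 2 * Lb * ε := by
    obtain ⟨-, h2, h3⟩ := hLip x y
    have : Lb * dist x y ≤ Lb * ε := mul_le_mul_of_nonneg_left hdy hLb
    linarith
  obtain ⟨hJ₁b, hJ₂b⟩ := hKJ (θ₀ x) (θ₀ y) (u₀ x) (u₀ y) ω (hθ x).1 (hθ x).2 (hθ y).1 (hθ y).2
    (hu x) (hu y)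
  have hJ₁' : |J₁ - θ₀ x| ≤ KJ * (2 * Lb) * ε :=
    hJ₁b.trans ((mul_le_mul_of_nonneg_left hpar hKJ0).trans_eq (by ring))
  have hJ₂' : |J₂ - θ₀ x * ⟪u₀ x, (ω : V3)⟫_ℝ| ≤ KJ * (2 * Lb) * ε :=
    hJ₂b.trans ((mul_le_mul_of_nonneg_left hpar hKJ0).trans_eq (by ring))
  have hθx : |θ₀ x| ≤ Θ := by
    rw [abs_of_nonneg (hθm.le.trans (hθ x).1)]; exact (hθ x).2
  have hux : |⟪u₀ x, (ω : V3)⟫_ℝ| ≤ U := (k2r_abs_inner_sphere_le ω _).trans (hu x)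
  have h := k2r_tb_alg hP hPP hdβ hdγ hJ₁' hJ₂' hθx hux
  convert h using 2

/-- **Registered sub-goal `stub_transferBound_pointwise`** (K2R line `birth`, stub G3b, helper II): the
pointwise `O(ε²)` replacement `k2r_tb_pointwise` in the position × direction transfer integrand, as a closed
statement. [cite: CIP1994, §3.1] -/
theorem stub_transferBound_pointwise :
    ∀ (θm Θ U R Lb Yb LY C KJ : ℝ), 0 < θm → 0 ≤ Lb → 0 ≤ LY → 0 ≤ KJ → ∀ (ρ₀ θ₀ : UnitAddTorus (Fin 3) → ℝ)
    (u₀ : UnitAddTorus (Fin 3) → EuclideanSpace ℝ (Fin 3)) (Yc : UnitAddTorus (Fin 3) → ℝ) (c₀ : UnitAddTorus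
    (Fin 3) → ℝ × EuclideanSpace ℝ (Fin 3) × ℝ), (∀ x, 0 ≤ ρ₀ x ∧ ρ₀ x ≤ R) → (∀ x, θm ≤ θ₀ x ∧ θ₀ x ≤ Θ) → (∀
    x, ‖u₀ x‖ ≤ U) → (∀ x x', |ρ₀ x - ρ₀ x'| ≤ Lb * dist x x' ∧ |θ₀ x - θ₀ x'| ≤ Lb * dist x x' ∧ ‖u₀ x - u₀
    x'‖ ≤ Lb * dist x x') → (∀ x, |Yc x| ≤ Yb) → (∀ x x', |Yc x - Yc x'| ≤ LY * dist x x') → (∀ x x', ‖c₀ x‖ ≤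
    C ∧ dist (c₀ x) (c₀ x') ≤ C * dist x x') → (∀ (θ θ' : ℝ) (u u' : EuclideanSpace ℝ (Fin 3)) (ω :
    Metric.sphere (0 : EuclideanSpace ℝ (Fin 3)) 1), θm ≤ θ → θ ≤ Θ → θm ≤ θ' → θ' ≤ Θ → ‖u‖ ≤ U → ‖u'‖ ≤ U →
    |(∫ v : EuclideanSpace ℝ (Fin 3), ∫ w : EuclideanSpace ℝ (Fin 3), max (inner ℝ (v - w) ω) 0 * inner ℝ (v -
    w) ω * (Literature.Analysis.FluidPDE.localMaxwellian 1 θ u v *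
    Literature.Analysis.FluidPDE.localMaxwellian 1 θ' u' w)) - θ| ≤ KJ * (|θ - θ'| + ‖u - u'‖) ∧ |(∫ v :
    EuclideanSpace ℝ (Fin 3), ∫ w : EuclideanSpace ℝ (Fin 3), max (inner ℝ (v - w) ω) 0 * inner ℝ (v - w) ω *
    (inner ℝ (v + w) ω / 2) * (Literature.Analysis.FluidPDE.localMaxwellian 1 θ u v *
    Literature.Analysis.FluidPDE.localMaxwellian 1 θ' u' w)) - θ * inner ℝ u ω| ≤ KJ * (|θ - θ'| + ‖u - u'‖))
    → ∀ (ε : ℝ), 0 ≤ ε → ∀ (x : UnitAddTorus (Fin 3)) (ω : Metric.sphere (0 : EuclideanSpace ℝ (Fin 3)) 1),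
    |-(Yc ((Literature.Analysis.FluidPDE.Torus.geometry (Fin 3)).translate x ((ε / 2) • (ω : EuclideanSpace ℝ
    (Fin 3)))) * ρ₀ x * ρ₀ ((Literature.Analysis.FluidPDE.Torus.geometry (Fin 3)).translate x (ε • (ω :
    EuclideanSpace ℝ (Fin 3)))) * (inner ℝ ((c₀ x).2.1 - (c₀ ((Literature.Analysis.FluidPDE.Torus.geometry
    (Fin 3)).translate x (ε • (ω : EuclideanSpace ℝ (Fin 3))))).2.1) ω * (∫ v : EuclideanSpace ℝ (Fin 3), ∫ w
    : EuclideanSpace ℝ (Fin 3), max (inner ℝ (v - w) ω) 0 * inner ℝ (v - w) ω *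
    (Literature.Analysis.FluidPDE.localMaxwellian 1 (θ₀ x) (u₀ x) v *
    Literature.Analysis.FluidPDE.localMaxwellian 1 (θ₀ ((Literature.Analysis.FluidPDE.Torus.geometry (Fin
    3)).translate x (ε • (ω : EuclideanSpace ℝ (Fin 3))))) (u₀ ((Literature.Analysis.FluidPDE.Torus.geometry
    (Fin 3)).translate x (ε • (ω : EuclideanSpace ℝ (Fin 3))))) w)) + ((c₀ x).2.2 - (c₀
    ((Literature.Analysis.FluidPDE.Torus.geometry (Fin 3)).translate x (ε • (ω : EuclideanSpace ℝ (Fin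
    3))))).2.2) * (∫ v : EuclideanSpace ℝ (Fin 3), ∫ w : EuclideanSpace ℝ (Fin 3), max (inner ℝ (v - w) ω) 0 *
    inner ℝ (v - w) ω * (inner ℝ (v + w) ω / 2) * (Literature.Analysis.FluidPDE.localMaxwellian 1 (θ₀ x) (u₀
    x) v * Literature.Analysis.FluidPDE.localMaxwellian 1 (θ₀ ((Literature.Analysis.FluidPDE.Torus.geometry
    (Fin 3)).translate x (ε • (ω : EuclideanSpace ℝ (Fin 3))))) (u₀
    ((Literature.Analysis.FluidPDE.Torus.geometry (Fin 3)).translate x (ε • (ω : EuclideanSpace ℝ (Fin 3)))))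
    w)))) - (-(Yc x * ρ₀ x ^ 2 * θ₀ x * inner ℝ ((c₀ x).2.1 - (c₀
    ((Literature.Analysis.FluidPDE.Torus.geometry (Fin 3)).translate x (ε • (ω : EuclideanSpace ℝ (Fin
    3))))).2.1) ω) - Yc x * ρ₀ x ^ 2 * θ₀ x * inner ℝ (u₀ x) ω * ((c₀ x).2.2 - (c₀
    ((Literature.Analysis.FluidPDE.Torus.geometry (Fin 3)).translate x (ε • (ω : EuclideanSpace ℝ (Fin
    3))))).2.2))| ≤ (2 * (Yb * R * R) * C * (KJ * (2 * Lb)) + (LY * R * R / 2 + Yb * R * Lb) * Θ * C * (1 +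
    U)) * ε ^ 2 :=
  fun _ _ _ _ _ _ _ _ _ hθm hLb hLY hKJ0 _ _ _ _ _ hρ hθ hu hLip hY hYL hc hKJ _ hε0 x ω =>
    k2r_tb_pointwise hθm hρ hθ hu hLb hLip hY hLY hYL hc hKJ0 hKJ hε0 x ω

end Summit.AtomisticToContinuum.HydrodynamicLimit.Theorems.EnskogAdjointDuality

end
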